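import Literature.AnabelianGeometry.EtaleTheta.ContH1
import Mathlib.Topology.Algebra.ClopenNhdofOne
import Mathlib.Topology.Algebra.OpenSubgroup
import Mathlib.GroupTheory.OrderOfElement
import HarnessLib

/-!
# Continuous `H¹` with profinite coefficients is SEPARATED: no non-trivial class is a coboundary modulo every
# open normal subgroup, and no non-trivial class is infinitely divisible (support file for [EtTh] §1)

Neukirch–Schmidt–Wingberg, *Cohomology of Number Fields*, I §2 / II §7 (continuous cochains with profinite
coefficients; `H¹` as crossed homomorphisms modulo principal ones) [cite: NeukirchSchmidtWingberg2008, I §2 and II §7];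
used for Mochizuki, *The étale theta function …*, Publ. RIMS **45** (2009) [EtTh], Remark 1.6.4 p. 252 — the
`Ẑ ∋ a` form of the action formula (c2) on the profinite classes `(η̈^Θ)^∧ ∈ H¹(Π_{Ÿ^∧}, Δ_Θ)` («on which any
`Π_X/Π_{Y^∧} ≅ Ẑ ∋ a` acts via …») [cite: MochizukiEtTh2009, Rmk 1.6.4 p.252], whose passage from `a ∈ ℤ` (the tempered
deck transformations) to `a ∈ Ẑ` needs to compare classes MODULO the open normal subgroups of the coefficient group
(abc-iut VNEXT «RMK164-(c2)-ZHAT», residual (r1) of the cone row EtTh:Rmk1.6.4).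

PROOF-ONLY (abc-iut cell, prover abc-iut-f-128 gen 8; generic `ContH1` API over abc-iut-L2-t1's carrier; no definitions,
no facts).  For the tree's `ContH1 φ A H` (continuous crossed homomorphisms `H → A` modulo principal ones, `A ⊴ G′`
abelian normal acted on by conjugation through `φ : G → G′`) with PROFINITE ambient coefficient group `G′` (compact,
Hausdorff, totally disconnected) and `A` closed:
* `ContH1.mem_contCoboundaries_of_forall_congr` — a (not even continuous) map `f : H → A` that is congruent to SOME
  coboundary modulo EVERY open normal subgroup `N ⊴ G′` IS a coboundary.  Proof: the sets
  `S_N = {a ∈ A | ∀ h, f(h)·(φ(h) a φ(h)⁻¹ a⁻¹)⁻¹ ∈ N}` are closed, non-empty and directed in the COMPACT `A`, so they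
  have a common point `a` (finite-intersection property), and `f(h)·(∂a)(h)⁻¹` lies in every `N`, hence is `1`;
* `ContH1.mk_eq_one_of_forall_congr` — the class form;
* `ContH1.eq_one_of_forall_pow_eq` — **no non-trivial class is infinitely divisible**: if for every `n ≥ 1` there is
  `y` with `yⁿ = x`, then `x = 1` (for `N` take `n :=` the index of the open subgroup `A ∩ N` of the compact `A`, so
  that `n`-th powers of `A` lie in `N`); `ContH1.eq_of_forall_pow_eq_div` — two classes whose quotient is infinitely
  divisible are equal.  I.e. `⋂ₙ (H¹)ⁿ = 1`: `H¹(H, A) ↪ limₙ H¹(H, A)/(H¹)ⁿ` — the «finite-coefficient limit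
  description» is faithful.
Mathlib only.  Nothing here bears on [IUTchIII] Cor. 3.12; the [EtTh] application is not made here.
-/

noncomputable section

namespace Literature.AnabelianGeometry.EtaleTheta

open scoped IsMulCommutative
open Topology

namespace ContH1

variable {G G' : Type*} [Group G] [TopologicalSpace G]
  [Group G'] [TopologicalSpace G'] [IsTopologicalGroup G']
  {φ : G →* G'} {A : Subgroup G'} [A.Normal] [IsMulCommutative A] {H : Subgroup G}

/-- An element of a profinite group lying in every open normal subgroup is trivial. [folklore] -/
private theorem eq_one_of_forall_mem_openNormal [CompactSpace G'] [T2Space G'] [TotallyDisconnectedSpace G']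
    (g : G') (hg : ∀ N : OpenNormalSubgroup G', g ∈ N.toSubgroup) : g = 1 := by
  by_contra hne
  obtain ⟨N, hN⟩ := ProfiniteGrp.exist_openNormalSubgroup_sub_open_nhds_of_one
    (isOpen_compl_singleton (x := g)) (show (1 : G') ∈ ({g}ᶜ : Set G') from fun h1 => hne h1.symm)
  exact hN (hg N) rfl

omit [TopologicalSpace G] [IsMulCommutative A] in
/-- Continuity of the coboundary of `a` at a fixed place `h`: `a ↦ φ(h) a φ(h)⁻¹ · a⁻¹` is continuous `A → G′`.
[folklore] -/
private theorem continuous_coboundary_apply (h : H) :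
    Continuous fun a : A => (((MulAut.conjNormal (φ (h : G)) a * a⁻¹ : A)) : G') := by
  have : (fun a : A => (((MulAut.conjNormal (φ (h : G)) a * a⁻¹ : A)) : G')) =
      fun a : A => φ (h : G) * (a : G') * (φ (h : G))⁻¹ * ((a : G'))⁻¹ := by
    funext a
    simp [MulAut.conjNormal_apply]
  rw [this]
  fun_prop

omit [TopologicalSpace G] in
/-- **A map congruent to a coboundary modulo every open normal subgroup is a coboundary** (profinite ambient
coefficients, `A` closed).  For `f : H → A` (no continuity or cocycle condition needed): if for every open normal
`N ⊴ G′` there is `a ∈ A` with `f(h) · (φ(h) a φ(h)⁻¹ a⁻¹)⁻¹ ∈ N` for all `h`, then `f` is the coboundary of some `a`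
— by compactness of `A` (finite-intersection property of the closed sets of such `a`) and `⋂ N = 1`.
[cite: NeukirchSchmidtWingberg2008, I §2 and II §7] -/
theorem mem_contCoboundaries_of_forall_congr [CompactSpace G'] [T2Space G'] [TotallyDisconnectedSpace G']
    (hA : IsClosed (A : Set G')) (f : H → A)
    (hf : ∀ N : OpenNormalSubgroup G', ∃ a : A, ∀ h : H,
      ((f h : A) : G') * ((((MulAut.conjNormal (φ (h : G)) a * a⁻¹ : A)) : G'))⁻¹ ∈ N.toSubgroup) :
    f ∈ contCoboundaries φ A H := by
  classical
  haveI : CompactSpace A := isCompact_iff_compactSpace.mp hA.isCompact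
  -- the closed, non-empty, directed family `S_N`
  haveI : Nonempty (OpenNormalSubgroup G') :=
    ⟨{ toOpenSubgroup := ⊤, isNormal' := by
        rw [OpenSubgroup.toSubgroup_top]
        infer_instance }⟩
  let S : OpenNormalSubgroup G' → Set A := fun N =>
    {a : A | ∀ h : H,
      ((f h : A) : G') * ((((MulAut.conjNormal (φ (h : G)) a * a⁻¹ : A)) : G'))⁻¹ ∈ N.toSubgroup}
  have hScl : ∀ N, IsClosed (S N) := by
    intro N
    have : S N = ⋂ h : H, (fun a : A =>
        ((f h : A) : G') * ((((MulAut.conjNormal (φ (h : G)) a * a⁻¹ : A)) : G'))⁻¹) ⁻¹'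
          ((N.toSubgroup : Subgroup G') : Set G') := by
      ext a
      simp only [Set.mem_setOf_eq, Set.mem_iInter, Set.mem_preimage, SetLike.mem_coe, S]
    rw [this]
    refine isClosed_iInter fun h => N.toOpenSubgroup.isClosed.preimage ?_
    exact continuous_const.mul (continuous_coboundary_apply (φ := φ) h).inv
  have hSne : ∀ N, (S N).Nonempty := fun N => hf N
  have hSdir : Directed (· ⊇ ·) S := by
    intro N₁ N₂
    refine ⟨N₁ ⊓ N₂, fun a ha h => ?_, fun a ha h => ?_⟩
    · exact (show (N₁ ⊓ N₂).toSubgroup ≤ N₁.toSubgroup from inf_le_left) (ha h)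
    · exact (show (N₁ ⊓ N₂).toSubgroup ≤ N₂.toSubgroup from inf_le_right) (ha h)
  obtain ⟨a, ha⟩ := IsCompact.nonempty_iInter_of_directed_nonempty_isCompact_isClosed S hSdir hSne
    (fun N => (hScl N).isCompact) hScl
  -- the common point `a` works everywhere
  refine (mem_contCoboundaries_iff f).mpr ⟨a, funext fun h => ?_⟩
  have hall : ∀ N : OpenNormalSubgroup G',
      ((f h : A) : G') * ((((MulAut.conjNormal (φ (h : G)) a * a⁻¹ : A)) : G'))⁻¹ ∈ N.toSubgroup :=
    fun N => (Set.mem_iInter.mp ha N) h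
  have h1 := eq_one_of_forall_mem_openNormal _ hall
  exact Subtype.ext (mul_inv_eq_one.mp h1)

/-- The class form: a continuous cocycle congruent to a coboundary modulo every open normal subgroup of the profinite
coefficient group has trivial class. [cite: NeukirchSchmidtWingberg2008, I §2 and II §7] -/
theorem mk_eq_one_of_forall_congr [CompactSpace G'] [T2Space G'] [TotallyDisconnectedSpace G']
    (hA : IsClosed (A : Set G')) (f : H → A) (hf : f ∈ contCocycles φ A H)
    (hcongr : ∀ N : OpenNormalSubgroup G', ∃ a : A, ∀ h : H,
      ((f h : A) : G') * ((((MulAut.conjNormal (φ (h : G)) a * a⁻¹ : A)) : G'))⁻¹ ∈ N.toSubgroup) :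
    ContH1.mk f hf = (1 : ContH1 φ A H) :=
  (QuotientGroup.eq_one_iff _).mpr (Subgroup.mem_subgroupOf.mpr (mem_contCoboundaries_of_forall_congr hA f hcongr))

omit [A.Normal] [IsMulCommutative A] in
/-- For an open normal `N ⊴ G′` of the compact `G′`: the trace `A ∩ N` has finite, positive index in `A`, and that
power of every element of `A` lies in `N`. [folklore] -/
private theorem exists_pow_mem [CompactSpace G'] (hA : IsClosed (A : Set G')) (N : OpenNormalSubgroup G') :
    ∃ n : ℕ, 0 < n ∧ ∀ a : A, ((a : G')) ^ n ∈ N.toSubgroup := by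
  haveI : CompactSpace A := isCompact_iff_compactSpace.mp hA.isCompact
  let M : Subgroup A := N.toSubgroup.comap A.subtype
  have hMo : IsOpen (M : Set A) := N.toOpenSubgroup.isOpen.preimage continuous_subtype_val
  haveI : Finite (A ⧸ M) := Subgroup.quotient_finite_of_isOpen M hMo
  haveI : M.FiniteIndex := Subgroup.finiteIndex_of_finite_quotient
  refine ⟨M.index, Nat.pos_of_ne_zero Subgroup.FiniteIndex.index_ne_zero, fun a => ?_⟩
  have h := M.pow_index_mem a
  rw [Subgroup.mem_comap, map_pow] at h
  exact h

/-- **Continuous `H¹` with profinite coefficients has no non-trivial infinitely divisible class**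
(`⋂ₙ (H¹)ⁿ = 1`): if for every `n ≥ 1` there is `y` with `yⁿ = x`, then `x = 1`.  (Given `N ⊴ G′` open normal, take
`n` with `Aⁿ ⊆ N`; a representative of `x` is then `gⁿ · ∂b ≡ ∂b (mod N)`; conclude by
`mem_contCoboundaries_of_forall_congr`.)  This is the faithfulness of the finite-coefficient description of `H¹`
needed to pass from `a ∈ ℤ` to `a ∈ Ẑ` in [EtTh] Rmk. 1.6.4 (c2). [cite: NeukirchSchmidtWingberg2008, I §2 and II §7]
[cite: MochizukiEtTh2009, Rmk 1.6.4 p.252] -/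
theorem eq_one_of_forall_pow_eq [CompactSpace G'] [T2Space G'] [TotallyDisconnectedSpace G']
    (hA : IsClosed (A : Set G')) (x : ContH1 φ A H)
    (hdiv : ∀ n : ℕ, 0 < n → ∃ y : ContH1 φ A H, y ^ n = x) : x = 1 := by
  induction x using QuotientGroup.induction_on with
  | H f =>
    change ContH1.mk f.1 f.2 = 1
    refine mk_eq_one_of_forall_congr hA f.1 f.2 fun N => ?_
    obtain ⟨n, hn, hpow⟩ := exists_pow_mem (A := A) hA N
    obtain ⟨y, hy⟩ := hdiv n hn
    induction y using QuotientGroup.induction_on with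
    | H g =>
      -- `gⁿ` and `f` define the same class: `(gⁿ)⁻¹ · f` is a coboundary `∂b`
      have hmem : (g ^ n)⁻¹ * f ∈ (contCoboundaries φ A H).subgroupOf (contCocycles φ A H) :=
        (QuotientGroup.eq (s := (contCoboundaries φ A H).subgroupOf (contCocycles φ A H))).mp (by
          rw [QuotientGroup.mk_pow]
          exact hy)
      obtain ⟨b, hb⟩ := (mem_contCoboundaries_iff _).mp (Subgroup.mem_subgroupOf.mp hmem)
      refine ⟨b, fun h => ?_⟩
      have hbh := congrFun hb h
      -- `((gⁿ)⁻¹ · f)(h) = ∂b(h)`, i.e. `f(h) · ∂b(h)⁻¹ = g(h)ⁿ ∈ N`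
      have hval : ((((g ^ n)⁻¹ * f : contCocycles φ A H) : H → A) h) = (g.1 h)⁻¹ ^ n * f.1 h := by
        simp only [Subgroup.coe_mul, Subgroup.coe_inv, Subgroup.coe_pow, Pi.mul_apply, Pi.inv_apply,
          Pi.pow_apply, inv_pow]
      rw [hval] at hbh
      have hf : f.1 h * (MulAut.conjNormal (φ (h : G)) b * b⁻¹)⁻¹ = (g.1 h) ^ n := by
        rw [← hbh]
        simp only [inv_pow, mul_inv_rev, inv_inv, mul_inv_cancel_left]
      have := hpow (g.1 h)
      rw [show ((f.1 h : A) : G') * ((((MulAut.conjNormal (φ (h : G)) b * b⁻¹ : A)) : G'))⁻¹ =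
          (((f.1 h * (MulAut.conjNormal (φ (h : G)) b * b⁻¹)⁻¹ : A)) : G') by
        simp only [Subgroup.coe_mul, Subgroup.coe_inv], hf, Subgroup.coe_pow]
      exact this

/-- Two classes whose quotient is infinitely divisible are equal. [cite: NeukirchSchmidtWingberg2008, I §2 and II §7] -/
theorem eq_of_forall_pow_eq_div [CompactSpace G'] [T2Space G'] [TotallyDisconnectedSpace G']
    (hA : IsClosed (A : Set G')) (x x' : ContH1 φ A H)
    (hdiv : ∀ n : ℕ, 0 < n → ∃ y : ContH1 φ A H, y ^ n = x / x') : x = x' :=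
  div_eq_one.mp (eq_one_of_forall_pow_eq hA (x / x') hdiv)

/-! ### Congruence of CLASSES modulo `N` through representatives (appended 2026-08-27, abc-iut «RMK164-ZHAT» (Z5) prep):
`eq_of_forall_exists_rep_congr`, `exists_rep_congr_mul` -/

/-- Change of representative: two cocycles with the same class differ by a coboundary, pointwise (a private copy
of abc-iut's `ContH1.exists_coboundary_of_mk_eq` of `Discharge/Sec2ThetaOrbitClasses.lean`, kept local to avoid the
§2 import). [folklore] -/
private theorem exists_coboundary_of_mk_eq' (f f₀ : contCocycles φ A H)
    (hf : (QuotientGroup.mk f : ContH1 φ A H) = QuotientGroup.mk f₀) :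
    ∃ b : A, ∀ h : H, f₀.1 h = f.1 h * (MulAut.conjNormal (φ (h : G)) b * b⁻¹) := by
  have hmem : f⁻¹ * f₀ ∈ (contCoboundaries φ A H).subgroupOf (contCocycles φ A H) :=
    (QuotientGroup.eq (s := (contCoboundaries φ A H).subgroupOf (contCocycles φ A H))).mp hf
  obtain ⟨b, hb⟩ := (mem_contCoboundaries_iff _).mp (Subgroup.mem_subgroupOf.mp hmem)
  refine ⟨b, fun h => ?_⟩
  have hbh := congrFun hb h
  have hval : (((f⁻¹ * f₀ : contCocycles φ A H) : H → A) h) = (f.1 h)⁻¹ * f₀.1 h := by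
    simp only [Subgroup.coe_mul, Subgroup.coe_inv, Pi.mul_apply, Pi.inv_apply]
  rw [hval] at hbh
  rw [← hbh, mul_inv_cancel_left]

/-- **Two classes with representatives congruent modulo every open normal subgroup are equal** (profinite ambient
coefficients, `A` closed): if for every open normal `N ⊴ G′` there are representing cocycles `f` of `x` and `g` of `y`
with `f(h)·g(h)⁻¹ ∈ N` for all `h`, then `x = y`.  (Fix representatives `f₀, g₀`; for each `N` the representatives `f, g`
differ from them by coboundaries `∂b₁, ∂b₂`, so `f₀ g₀⁻¹ · ∂(b₁b₂⁻¹)⁻¹ = f g⁻¹ ≡ 1 (mod N)`; conclude by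
`mem_contCoboundaries_of_forall_congr`.) [cite: NeukirchSchmidtWingberg2008, I §2 and II §7] -/
theorem eq_of_forall_exists_rep_congr [CompactSpace G'] [T2Space G'] [TotallyDisconnectedSpace G']
    (hA : IsClosed (A : Set G')) (x y : ContH1 φ A H)
    (hxy : ∀ N : OpenNormalSubgroup G', ∃ f g : contCocycles φ A H,
      (QuotientGroup.mk f : ContH1 φ A H) = x ∧ (QuotientGroup.mk g : ContH1 φ A H) = y ∧
        ∀ h : H, ((f.1 h : A) : G') * (((g.1 h : A) : G'))⁻¹ ∈ N.toSubgroup) :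
    x = y := by
  induction x using QuotientGroup.induction_on with
  | H f₀ =>
    induction y using QuotientGroup.induction_on with
    | H g₀ =>
      -- it suffices that `f₀ g₀⁻¹` is a coboundary
      suffices hcob : (f₀ * g₀⁻¹ : contCocycles φ A H).1 ∈ contCoboundaries φ A H by
        have h1 : (QuotientGroup.mk (f₀ * g₀⁻¹) : ContH1 φ A H) = 1 :=
          (QuotientGroup.eq_one_iff _).mpr (Subgroup.mem_subgroupOf.mpr hcob)
        rw [QuotientGroup.mk_mul, QuotientGroup.mk_inv, mul_inv_eq_one] at h1
        exact h1
      refine mem_contCoboundaries_of_forall_congr hA _ fun N => ?_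
      obtain ⟨f, g, hf, hg, hcongr⟩ := hxy N
      obtain ⟨b₁, hb₁⟩ := exists_coboundary_of_mk_eq' f f₀ hf
      obtain ⟨b₂, hb₂⟩ := exists_coboundary_of_mk_eq' g g₀ hg
      refine ⟨b₁ * b₂⁻¹, fun h => ?_⟩
      -- the key pointwise identity in the abelian group `A`
      have key : (f₀ * g₀⁻¹ : contCocycles φ A H).1 h * (MulAut.conjNormal (φ (h : G)) (b₁ * b₂⁻¹) * (b₁ * b₂⁻¹)⁻¹)⁻¹ =
          f.1 h * (g.1 h)⁻¹ := by
        have hval : (f₀ * g₀⁻¹ : contCocycles φ A H).1 h = f₀.1 h * (g₀.1 h)⁻¹ := by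
          simp only [Subgroup.coe_mul, Subgroup.coe_inv, Pi.mul_apply, Pi.inv_apply]
        rw [hval, hb₁ h, hb₂ h]
        apply Additive.ofMul.injective
        simp only [map_mul, map_inv, mul_inv_rev, inv_inv, ofMul_mul, ofMul_inv]
        abel
      have key' := congrArg (fun a : A => (a : G')) key
      have hc := hcongr h
      simp only [Subgroup.coe_mul, Subgroup.coe_inv] at key' hc ⊢
      rw [key']
      exact hc

/-- **Congruence of representatives is multiplicative**: representatives of `x₁, y₁` congruent mod `N` and of
`x₂, y₂` congruent mod `N` give representatives of `x₁x₂`, `y₁y₂` congruent mod `N` (the products; `A` abelian, `N` a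
subgroup). [cite: NeukirchSchmidtWingberg2008, I §2 and II §7] -/
theorem exists_rep_congr_mul (N : Subgroup G')
    {x₁ y₁ x₂ y₂ : ContH1 φ A H}
    (h₁ : ∃ f g : contCocycles φ A H, (QuotientGroup.mk f : ContH1 φ A H) = x₁ ∧
      (QuotientGroup.mk g : ContH1 φ A H) = y₁ ∧ ∀ h : H, ((f.1 h : A) : G') * (((g.1 h : A) : G'))⁻¹ ∈ N)
    (h₂ : ∃ f g : contCocycles φ A H, (QuotientGroup.mk f : ContH1 φ A H) = x₂ ∧
      (QuotientGroup.mk g : ContH1 φ A H) = y₂ ∧ ∀ h : H, ((f.1 h : A) : G') * (((g.1 h : A) : G'))⁻¹ ∈ N) :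
    ∃ f g : contCocycles φ A H, (QuotientGroup.mk f : ContH1 φ A H) = x₁ * x₂ ∧
      (QuotientGroup.mk g : ContH1 φ A H) = y₁ * y₂ ∧
        ∀ h : H, ((f.1 h : A) : G') * (((g.1 h : A) : G'))⁻¹ ∈ N := by
  obtain ⟨f₁, g₁, hf₁, hg₁, hc₁⟩ := h₁
  obtain ⟨f₂, g₂, hf₂, hg₂, hc₂⟩ := h₂
  refine ⟨f₁ * f₂, g₁ * g₂, ?_, ?_, fun h => ?_⟩
  · rw [QuotientGroup.mk_mul]
    exact congrArg₂ (· * ·) hf₁ hf₂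
  · rw [QuotientGroup.mk_mul]
    exact congrArg₂ (· * ·) hg₁ hg₂
  have key : ((f₁ * f₂ : contCocycles φ A H).1 h) * ((g₁ * g₂ : contCocycles φ A H).1 h)⁻¹ =
      (f₁.1 h * (g₁.1 h)⁻¹) * (f₂.1 h * (g₂.1 h)⁻¹) := by
    have hv1 : (f₁ * f₂ : contCocycles φ A H).1 h = f₁.1 h * f₂.1 h := rfl
    have hv2 : (g₁ * g₂ : contCocycles φ A H).1 h = g₁.1 h * g₂.1 h := rfl
    rw [hv1, hv2]
    apply Additive.ofMul.injective
    simp only [mul_inv_rev, ofMul_mul, ofMul_inv]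
    abel
  have key' := congrArg (fun a : A => (a : G')) key
  have hc := N.mul_mem (hc₁ h) (hc₂ h)
  simp only [Subgroup.coe_mul, Subgroup.coe_inv] at key' hc ⊢
  rw [key']
  exact hc

end ContH1

end Literature.AnabelianGeometry.EtaleTheta

end
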